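import Summits.CriticalPhenomena.PercolationContinuityZ3.Theorems.PercNearOneGluingNoHeavyRsw3HardCrossingRate
import Summits.CriticalPhenomena.PercolationContinuityZ3.Theorems.PercNearOneGluingNoHeavyRsw3LocalisedCrossingsCritical
import Summits.CriticalPhenomena.PercolationContinuityZ3.Theorems.PercNearOneGluingNoHeavyOneArmDecayRate
import Summits.CriticalPhenomena.PercolationContinuityZ3.Theorems.PercAnnulusCrossingBoxCrossingLength
import HarnessLib

/-!
# RSW3 lane (P2, gen 7): the hard-crossing rate characterises the critical point —
# `p < p_c(ℤ³)` iff the rate `γ_p(N)` of `…Rsw3HardCrossingRate` stays bounded below as the width `N` grows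

builds on p205010 (kernel theorem, internal audit signed; external expert review pending)

Cell `prim-rsw3`, prover seat `prim-rsw3-p2` (gen 7), memo `run/shared/lean/prim/rsw3/P2-RSWLITE.md` §13.
Support file (`--supports stmt-CriticalPhenomena-4575`); no definitions, no named facts, no sorries.

With `H_p(ℓ, N) = P_p(boxCross ![ℓ, N, N] 0)` and `γ_p(N) = lim_ℓ -log H_p(ℓ, N)/ℓ` (`Rsw3.exists_hardCrossingRate`):
* `real_boxCross_tube_le_sq_mul_oneArmProb` (every `p`): `H_p(ℓ, N) ≤ (N+1)² π_p(ℓ)` — a crossing starts at one of the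
  `≤ (N+1)²` points of the near face and is, from there, a one-arm event to sup-distance `ℓ`
  (`Rsw3.real_linked_singleton_le_oneArmProb`);
* `exists_le_hardCrossingRate_of_lt_criticalProb`: for `0 < p < p_c` there is `c = c(p) > 0` with `γ_p(N) ≥ c` for EVERY `N`
  (sharpness: `π_p(ℓ) ≤ 6 e^{-φ(p) ℓ}`, `φ(p) > 0`, `RSW3.oneArmProb_le_mul_exp_neg` / `RSW3.lim_oneArm_pos_of_lt_criticalProb`);
* `hardCrossingRate_anti` (every `p`): `γ_p(N') ≤ γ_p(N)` for `N ≤ N'` (a wider tube is crossed more easily, Kesten's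
  Comment (v), `Crossing.real_boxCross_anti`) — so "bounded below in `N`" below is about the `N → ∞` limit;
* `lt_criticalProb_iff_hardCrossingRate_bounded_below`: for `0 < p`,
  **`p < p_c(ℤ³) ⟺ ∃ c > 0 ∀ N ≥ 1: γ_p(N) ≥ c`** — at `p ≥ p_c`, `γ_p(N) ≤ γ_{p_c}(N) ≤ (4 log N + C)/N → 0` (monotonicity in `p`,
  `Rsw3.hardCrossingRate_criticalProbI_le`).
So the per-LENGTH rate of hard crossings separates the phases exactly like an inverse correlation length: bounded below in
the width below `p_c`, tending to `0` in the width at `p_c` (at most `(4 log N + C)/N`; RSW would say `≈ 2.74/N`).  A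
finite-size-type characterisation of `p_c` by hard crossings, companion of the annulus criterion
`Rsw3.lt_criticalProb_iff_exists_real_boxCrossing_lt` (gen 2).  HONEST SIZE: bookkeeping on tree inputs.

References: M. V. Menshikov (1986) / M. Aizenman, D. Barsky (1987) / H. Duminil-Copin, V. Tassion, CMP 343 (2016) (sharpness,
tree `perc_sharpness_holds`); G. Grimmett, *Percolation* (1999), Thm. (6.10), (6.44); H. Kesten (1982) §3.3, Thm. 5.1. [folklore]
-/

noncomputable section

namespace Summit.CriticalPhenomena.PercolationContinuityZ3.Theorems

open MeasureTheory ProbabilityTheory Filter Topology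
open Literature.Probability.Percolation Literature.Probability.LatticeModels
open Literature.Barriers.CriticalPhenomena

namespace Rsw3

open SurfaceTension Crossing

/-- The near face of `{0..ℓ} × {0..N}²` has at most `(N+1)²` points. [folklore] -/
theorem card_nearFace_tube_le (ℓ N : ℕ) :
    (((Finset.Icc 0 (![(ℓ : ℤ), N, N] : Site 3)).filter (fun x => x 0 = 0)).card : ℝ) ≤ ((N : ℝ) + 1) ^ 2 := by
  classical
  set F := (Finset.Icc 0 (![(ℓ : ℤ), N, N] : Site 3)).filter (fun x => x 0 = 0) with hF
  set T : Finset (ℤ × ℤ) := Finset.Icc (0 : ℤ) N ×ˢ Finset.Icc (0 : ℤ) N with hT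
  have hmaps : ∀ x ∈ F, (x 1, x 2) ∈ T := by
    intro x hx
    obtain ⟨hx, -⟩ := Finset.mem_filter.1 hx
    rw [Finset.mem_Icc] at hx
    have h1 := hx.1 1; have h2 := hx.2 1; have h3 := hx.1 2; have h4 := hx.2 2
    simp only [Pi.zero_apply, Matrix.cons_val_one, Matrix.cons_val_two, Matrix.head_cons,
      Matrix.tail_cons] at h1 h2 h3 h4
    rw [hT, Finset.mem_product, Finset.mem_Icc, Finset.mem_Icc]
    exact ⟨⟨h1, h2⟩, h3, h4⟩
  have hinj : Set.InjOn (fun x : Site 3 => (x 1, x 2)) ↑F := by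
    intro x hx y hy hxy
    simp only [Prod.mk.injEq] at hxy
    have hx0 := (Finset.mem_filter.1 (Finset.mem_coe.1 hx)).2
    have hy0 := (Finset.mem_filter.1 (Finset.mem_coe.1 hy)).2
    funext j
    fin_cases j
    · exact hx0.trans hy0.symm
    · exact hxy.1
    · exact hxy.2
  have hcard : F.card ≤ T.card := Finset.card_le_card_of_injOn _ hmaps hinj
  have hT_card : T.card = (N + 1) * (N + 1) := by
    rw [hT, Finset.card_product, Int.card_Icc]
    simp
  calc (F.card : ℝ) ≤ T.card := by exact_mod_cast hcard
    _ = ((N : ℝ) + 1) ^ 2 := by rw [hT_card]; push_cast; ring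

/-- **`H_p(ℓ, N) ≤ (N+1)² π_p(ℓ)`** (every `p`): a lengthwise crossing of `{0..ℓ} × {0..N}²` issues from one of the points of
the near face, and from a POINT the far face (sup-distance `ℓ`) is reached only on the one-arm event
(`real_linked_singleton_le_oneArmProb`). [folklore] -/
theorem real_boxCross_tube_le_sq_mul_oneArmProb (p : unitInterval) (ℓ N : ℕ) :
    (bondPercolation (zdGraph 3) p).real (boxCross (![(ℓ : ℤ), N, N] : Site 3) 0) ≤
      ((N : ℝ) + 1) ^ 2 * oneArmProb 3 p ℓ := by
  classical
  set μ := bondPercolation (zdGraph 3) p with hμ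
  set blk : Finset (Site 3) := Finset.Icc 0 (![(ℓ : ℤ), N, N] : Site 3) with hblk
  set F₀ : Finset (Site 3) := blk.filter (fun x => x 0 = 0) with hF₀
  set F₁ : Set (Site 3) := {x | x ∈ blk ∧ x 0 = ℓ} with hF₁
  set E : Site 3 → Set (BondConfig (Site 3)) := fun x => linked (↑blk : Set (Site 3)) {x} F₁ with hE
  have h1 : μ.real (boxCross (![(ℓ : ℤ), N, N] : Site 3) 0) ≤ ∑ x ∈ F₀, μ.real (E x) := by
    refine le_trans ?_ (measureReal_biUnion_finset_le F₀ E)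
    refine DCT16.real_mono_of_forall_subset_edgeSet (zdGraph 3) p fun ω hω h => ?_
    simp only [boxCross, Set.mem_setOf_eq] at h
    obtain ⟨x, hx, y, hy, hxi, hyi, hxy⟩ := h
    have hr := Quant.reachable_within_of_pathIn hω (DCT16.pathIn_of_mem_openConnIn hxy)
    have hyℓ : y 0 = ℓ := by rw [hyi]; simp
    refine Set.mem_iUnion₂.2 ⟨x, Finset.mem_filter.2 ⟨hx, hxi⟩, ?_⟩
    exact mem_linked_iff.2 ⟨x, rfl, y, ⟨hy, hyℓ⟩, mem_inConn_iff.2 hr⟩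
  have h2 : ∀ x ∈ F₀, μ.real (E x) ≤ oneArmProb 3 p ℓ := by
    intro x hx
    have hx0 : x 0 = 0 := (Finset.mem_filter.1 hx).2
    refine real_linked_singleton_le_oneArmProb p (↑blk) F₁ x ℓ fun t ht => ?_
    rw [ht.2, hx0]; ring
  calc μ.real (boxCross (![(ℓ : ℤ), N, N] : Site 3) 0) ≤ ∑ x ∈ F₀, μ.real (E x) := h1
    _ ≤ ∑ _x ∈ F₀, oneArmProb 3 p ℓ := Finset.sum_le_sum h2
    _ = F₀.card * oneArmProb 3 p ℓ := by rw [Finset.sum_const, nsmul_eq_mul]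
    _ ≤ ((N : ℝ) + 1) ^ 2 * oneArmProb 3 p ℓ :=
        mul_le_mul_of_nonneg_right (card_nearFace_tube_le ℓ N) measureReal_nonneg

/-- **Below `p_c` the hard-crossing rate is bounded below, uniformly in the width**: for `0 < p < p_c(ℤ³)` there is
`c > 0` such that every limit `γ` of `-log H_p(ℓ, N)/ℓ` (every `N`) satisfies `c ≤ γ`.  From `H_p(ℓ, N) ≤ (N+1)² π_p(ℓ)`
and sharpness `π_p(ℓ) ≤ 6 e^{-φ ℓ}`, `φ = φ(p) > 0`. [folklore] -/
theorem exists_le_hardCrossingRate_of_lt_criticalProb (p : unitInterval) (hp : 0 < (p : ℝ))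
    (hpc : (p : ℝ) < criticalProb (zdGraph 3) 0) :
    ∃ c : ℝ, 0 < c ∧ ∀ N : ℕ, ∀ γ : ℝ,
      Tendsto (fun ℓ : ℕ =>
        -Real.log ((bondPercolation (zdGraph 3) p).real (boxCross (![(ℓ : ℤ), N, N] : Site 3) 0)) / ℓ)
        atTop (𝓝 γ) → c ≤ γ := by
  set φ : ℝ := (RSW3.subadditive_oneArm (d := 3) (by norm_num) p hp).lim with hφ
  have hφ0 : 0 < φ := RSW3.lim_oneArm_pos_of_lt_criticalProb (d := 3) (by norm_num) p hp hpc
  refine ⟨φ, hφ0, fun N γ hγ => ?_⟩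
  set μ := bondPercolation (zdGraph 3) p with hμ
  set H : ℕ → ℝ := fun ℓ => μ.real (boxCross (![(ℓ : ℤ), N, N] : Site 3) 0) with hH
  have hHpos : ∀ ℓ, 0 < H ℓ := fun ℓ => lt_of_lt_of_le (pow_pos hp ℓ) (pow_le_real_boxCross_tube p ℓ N)
  -- `H ℓ ≤ 6 (N+1)² e^{-φ ℓ}`
  set A : ℝ := ((N : ℝ) + 1) ^ 2 * (2 * (3 : ℕ)) with hA
  have hA0 : 0 < A := by positivity
  have hbound : ∀ ℓ : ℕ, H ℓ ≤ A * Real.exp (-φ * ℓ) := by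
    intro ℓ
    have h1 := real_boxCross_tube_le_sq_mul_oneArmProb p ℓ N
    have h2 := RSW3.oneArmProb_le_mul_exp_neg (d := 3) (by norm_num) p hp ℓ
    calc H ℓ ≤ ((N : ℝ) + 1) ^ 2 * oneArmProb 3 p ℓ := h1
      _ ≤ ((N : ℝ) + 1) ^ 2 * (2 * (3 : ℕ) * Real.exp (-φ * ℓ)) := mul_le_mul_of_nonneg_left h2 (by positivity)
      _ = A * Real.exp (-φ * ℓ) := by rw [hA]; ring
  -- hence `-log H ℓ / ℓ ≥ φ - log A / ℓ → φ`
  have hlow : ∀ ℓ : ℕ, 1 ≤ ℓ → φ - Real.log A / ℓ ≤ -Real.log (H ℓ) / ℓ := by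
    intro ℓ hℓ
    have hℓ0 : (0 : ℝ) < ℓ := by exact_mod_cast hℓ
    have hlog : Real.log (H ℓ) ≤ Real.log A + -φ * ℓ := by
      have h := Real.log_le_log (hHpos ℓ) (hbound ℓ)
      rwa [Real.log_mul hA0.ne' (Real.exp_pos _).ne', Real.log_exp] at h
    rw [sub_le_iff_le_add, ← add_div, le_div_iff₀ hℓ0]
    linarith
  have hlim : Tendsto (fun ℓ : ℕ => φ - Real.log A / ℓ) atTop (𝓝 (φ - 0)) :=
    tendsto_const_nhds.sub (tendsto_const_nhds.div_atTop tendsto_natCast_atTop_atTop)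
  rw [sub_zero] at hlim
  exact le_of_tendsto_of_tendsto hlim hγ (by
    filter_upwards [eventually_ge_atTop 1] with ℓ hℓ using hlow ℓ hℓ)

/-- **The hard-crossing rate is non-increasing in the width** (every `p > 0`): if `N ≤ N'` then every limit `γ'` of
`-log H_p(ℓ, N')/ℓ` is `≤` every limit `γ` of `-log H_p(ℓ, N)/ℓ` — `H_p(ℓ, N) ≤ H_p(ℓ, N')` termwise (Kesten's Comment (v),
`Crossing.real_boxCross_anti`). [cite: Kesten1982, §3.3 Comment (v)] -/
theorem hardCrossingRate_anti (p : unitInterval) (hp : 0 < (p : ℝ)) {N N' : ℕ} (hNN' : N ≤ N') {γ γ' : ℝ}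
    (hγ : Tendsto (fun ℓ : ℕ =>
      -Real.log ((bondPercolation (zdGraph 3) p).real (boxCross (![(ℓ : ℤ), N, N] : Site 3) 0)) / ℓ) atTop (𝓝 γ))
    (hγ' : Tendsto (fun ℓ : ℕ =>
      -Real.log ((bondPercolation (zdGraph 3) p).real (boxCross (![(ℓ : ℤ), N', N'] : Site 3) 0)) / ℓ) atTop (𝓝 γ')) :
    γ' ≤ γ := by
  refine le_of_tendsto_of_tendsto' hγ' hγ fun ℓ => ?_
  have hmono : (bondPercolation (zdGraph 3) p).real (boxCross (![(ℓ : ℤ), N, N] : Site 3) 0) ≤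
      (bondPercolation (zdGraph 3) p).real (boxCross (![(ℓ : ℤ), N', N'] : Site 3) 0) := by
    refine real_boxCross_anti p (L := ![(ℓ : ℤ), N', N']) (L' := ![(ℓ : ℤ), N, N]) (i := 0) (by simp) (by simp) ?_
    intro j hj
    fin_cases j
    · exact absurd rfl hj
    · simp; exact_mod_cast hNN'
    · simp; exact_mod_cast hNN'
  have hpos : 0 < (bondPercolation (zdGraph 3) p).real (boxCross (![(ℓ : ℤ), N, N] : Site 3) 0) :=
    lt_of_lt_of_le (pow_pos hp ℓ) (pow_le_real_boxCross_tube p ℓ N)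
  rcases Nat.eq_zero_or_pos ℓ with rfl | hℓ
  · simp
  · have hℓ0 : (0 : ℝ) < ℓ := by exact_mod_cast hℓ
    apply div_le_div_of_nonneg_right _ hℓ0.le
    linarith [Real.log_le_log hpos hmono]

/-- **The hard-crossing rate characterises `p_c(ℤ³)`** (`0 < p`):
`p < p_c ⟺ ∃ c > 0 ∀ N ≥ 1 ∀ γ, (-log H_p(ℓ, N)/ℓ → γ) → c ≤ γ`.  `⇒`: sharpness
(`exists_le_hardCrossingRate_of_lt_criticalProb`).  `⇐`: for `p ≥ p_c`, `H_p ≥ H_{p_c}` (increasing event), so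
`γ_p(N) ≤ γ_{p_c}(N) ≤ (4 log N + C)/N` (`hardCrossingRate_criticalProbI_le`), which is `< c` for `N` large
(`log N ≤ 2√N`). [folklore] -/
theorem lt_criticalProb_iff_hardCrossingRate_bounded_below (p : unitInterval) (hp : 0 < (p : ℝ)) :
    (p : ℝ) < criticalProb (zdGraph 3) 0 ↔
      ∃ c : ℝ, 0 < c ∧ ∀ N : ℕ, 1 ≤ N → ∀ γ : ℝ,
        Tendsto (fun ℓ : ℕ =>
          -Real.log ((bondPercolation (zdGraph 3) p).real (boxCross (![(ℓ : ℤ), N, N] : Site 3) 0)) / ℓ)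
          atTop (𝓝 γ) → c ≤ γ := by
  constructor
  · intro hpc
    obtain ⟨c, hc, h⟩ := exists_le_hardCrossingRate_of_lt_criticalProb p hp hpc
    exact ⟨c, hc, fun N _ γ hγ => h N γ hγ⟩
  · rintro ⟨c, hc, h⟩
    by_contra hnot
    push Not at hnot
    -- `p_c ≤ p`
    have hpc0 : (0 : ℝ) < (criticalProbI 3 : unitInterval) := by
      rw [coe_criticalProbI]; exact criticalProb_zd_pos 3 (by norm_num)
    have hle : (criticalProbI 3 : unitInterval) ≤ p := by
      change ((criticalProbI 3 : unitInterval) : ℝ) ≤ (p : ℝ)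
      rw [coe_criticalProbI]; exact hnot
    obtain ⟨C, hC⟩ := hardCrossingRate_criticalProbI_le
    -- a large width `N` (the thresholds are abstracted so that no division by `c` enters the arithmetic)
    set K₁ : ℝ := 256 / c ^ 2 with hK₁
    set K₂ : ℝ := 2 * |C| / c with hK₂
    have hK₁0 : 0 ≤ K₁ := by positivity
    have hK₂0 : 0 ≤ K₂ := by positivity
    obtain ⟨N, hN⟩ : ∃ N : ℕ, K₁ + K₂ + 1 ≤ N := exists_nat_ge _
    have hN1 : 1 ≤ N := by
      have : (1 : ℝ) ≤ N := by linarith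
      exact_mod_cast this
    have hN0 : (0 : ℝ) < N := by exact_mod_cast hN1
    have hNK₁ : K₁ ≤ N := by linarith
    have hNK₂ : K₂ < N := by linarith
    -- the two rates at width `N`
    obtain ⟨γp, -, hγp, -, -⟩ := exists_hardCrossingRate p hp N
    obtain ⟨γc, -, hγc, -, -⟩ := exists_hardCrossingRate (criticalProbI 3) hpc0 N
    have h1 : c ≤ γp := h N hN1 γp hγp
    -- `γp ≤ γc`: `H_{p_c} ≤ H_p` termwise
    have h2 : γp ≤ γc := by
      refine le_of_tendsto_of_tendsto' hγp hγc fun ℓ => ?_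
      have hmono : (bondPercolation (zdGraph 3) (criticalProbI 3)).real (boxCross (![(ℓ : ℤ), N, N] : Site 3) 0) ≤
          (bondPercolation (zdGraph 3) p).real (boxCross (![(ℓ : ℤ), N, N] : Site 3) 0) :=
        DCT16.real_mono_of_isUpperSet (zdGraph 3) (isUpperSet_boxCross _ _) (measurableSet_boxCross _ _) hle
      have hpos : 0 < (bondPercolation (zdGraph 3) (criticalProbI 3)).real (boxCross (![(ℓ : ℤ), N, N] : Site 3) 0) :=
        lt_of_lt_of_le (pow_pos hpc0 ℓ) (pow_le_real_boxCross_tube _ ℓ N)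
      rcases Nat.eq_zero_or_pos ℓ with rfl | hℓ
      · simp
      · have hℓ0 : (0 : ℝ) < ℓ := by exact_mod_cast hℓ
        apply div_le_div_of_nonneg_right _ hℓ0.le
        linarith [Real.log_le_log hpos hmono]
    -- `N γc ≤ 4 log N + C < c N`
    have h3 : (N : ℝ) * γc ≤ 4 * Real.log N + C := hC N hN1 γc hγc
    have hlogN : Real.log N ≤ 2 * Real.sqrt N := by
      have hs : 0 < Real.sqrt N := Real.sqrt_pos.2 hN0
      have h := Real.log_le_sub_one_of_pos hs
      rw [Real.log_sqrt hN0.le] at h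
      linarith
    have hsqrt : 16 / c ≤ Real.sqrt N := by
      have : (16 / c) ^ 2 ≤ N := by
        calc (16 / c) ^ 2 = 256 / c ^ 2 := by rw [div_pow]; norm_num
          _ = K₁ := hK₁.symm
          _ ≤ N := hNK₁
      calc 16 / c = Real.sqrt ((16 / c) ^ 2) := (Real.sqrt_sq (by positivity)).symm
        _ ≤ Real.sqrt N := Real.sqrt_le_sqrt this
    have hsN : Real.sqrt N * Real.sqrt N = N := Real.mul_self_sqrt hN0.le
    -- `16 √N ≤ c N` and `2 C < c N`
    have h4 : 16 * Real.sqrt N ≤ c * N := by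
      have h16 : 16 ≤ c * Real.sqrt N := by
        have := mul_le_mul_of_nonneg_left hsqrt hc.le
        rwa [mul_div_cancel₀ _ hc.ne'] at this
      have h' := mul_le_mul_of_nonneg_right h16 (Real.sqrt_nonneg (N : ℝ))
      rw [mul_assoc, hsN] at h'
      exact h'
    have h5 : 2 * C < c * N := by
      have h' : 2 * |C| / c < N := by rw [← hK₂]; exact hNK₂
      have h'' : 2 * |C| < (N : ℝ) * c := (div_lt_iff₀ hc).1 h'
      nlinarith [le_abs_self C, mul_comm (N : ℝ) c]
    have h6 : (N : ℝ) * γc < c * N := by linarith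
    have h7 : c * N ≤ (N : ℝ) * γc := by
      have := mul_le_mul_of_nonneg_right (h1.trans h2) hN0.le
      linarith [mul_comm (N : ℝ) γc]
    linarith

end Rsw3

end Summit.CriticalPhenomena.PercolationContinuityZ3.Theorems

end
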